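import Summits.HodgeConjecture.HodgeConjecture.Theorems.F0P3cStCharTSCharacterEllipticUniformRamified  -- ★ H-RAM (LH6-p04 g11): the PLACE-FREE `_of_involution` letters∕head (used BY NAME) + the tame `_of_neg` twins (pattern); brings ★ 41g-H, ★ FramesOfInvolution (`exists_frame_mapGL_stdLattice`)
import Summits.HodgeConjecture.HodgeConjecture.Theorems.F0P3cDyRamWildPlaceDatum                    -- ★ (LH4-p02): `exists_isRamifiedQuadraticDatum_of_placesOver` (the ramified quadratic datum at a CM place, ANY uniformiser)
import Summits.HodgeConjecture.HodgeConjecture.Theorems.F0P3cDyRamWildTransitivity                  -- ★ p854580 (LH4-p02): `htr₂_of_isRamifiedQuadraticDatum` (type-two transitivity at the datum)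
import Literature.NumberTheory.Automorphic.UnitaryLatticeTreeEulerRelationWild                         -- ★ p854681 (LH4-p01): `isTree_latticeGraph_three_of_ramified` (the tree at every ramified datum); brings ★ htr₀-WILD `exists_unitary_mapGL_stdLattice_eq_of_isSelfDualLattice_of_ramified`
import Literature.NumberTheory.Automorphic.UnitaryLatticeTreeRootStarCountWild                          -- ★ (LH4-p01): `ncard_neighborSet_of_isSelfDualLattice_wild` (root-type stars have `q + 1` points); brings ★ `…TypeTwoStarCountWild` (`ncard_neighborSet_of_isVertexLattice_two_of_isRamifiedQuadraticDatum`)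
import HarnessLib

/-!
# K2-LIT E3 · WILD CHAIN «H-W» — file `K2E3CharacterEllipticUniformWild`: (SS-K) UNIFORM AT THE DATUM AT EVERY RAMIFIED PLACE (wild dyadic included)
# `𝔇.char π γ = Σ_{x ∈ X^γ} tr(γ | π^{U_x}) − Σ_{d ∈ X₁^γ} tr(γ | π^{U_d})` on the `U(Φ₃)(L⁺_v)` tree over the RAMIFIED QUADRATIC DATUM [SS97 III.4.16; Korman2004 Thm. 40]

Cell `pub/hodgecm-mathlib` (D-0151), Track B «K2-LIT» engine E3, socket item `stmt-HodgeConjecture-24833` (h413; lane `--supports … --as helper`); seat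
`hodgecm-mathlib-K2E3-p15` (g0); dealer K2E3-plan (g1) DEALS BATCH #2 (22:15:20Z) «H-W»; wild engine line lead K2E3-p17.  THEOREMS ONLY (no definition ∕ instance ∕
notation ∕ named fact ∕ `sorry`); ★-only imports.  Namespace `Summit.HodgeConjecture.HodgeConjecture.Cruxes.H413.K2E3CharacterEllipticUniformWild`.

WHAT.  The WILD twins of the two TAME (`_of_neg`: `σ_w ϖ = −ϖ`, `|2|_w = 1`) theorems of ★ H-RAM `F0P3cStCharTSCharacterEllipticUniformRamified`, discharged at EVERY
ramified place `w ∣ v` (`e(w∣v) ≠ 1`, ANY uniformiser `ϖ`, no parity ∕ tameness condition) through Track A's RAMIFIED QUADRATIC DATUM `IsRamifiedQuadraticDatum σ_w ϖ d t`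
(★ `exists_isRamifiedQuadraticDatum_of_placesOver`), token map = K2E3-p21 ∕ K2E3-p17's (`(hσ hvσ hϖ hσϖ hres h2 hnorm) ↦ (hew) (hϖ)`, names `…_of_ramificationIdx_ne_one`,
conclusions VERBATIM):
* §1 `exists_frame_three_of_isSelfDualLattice_of_isRamifiedQuadraticDatum` — the FRAMES letter `hfr` of the place-free heads at the datum (every self-dual `M` is `κ · L_a`,
  `κ ∈ K₀`, `a : ℤ`): ★ htr₀-WILD `exists_unitary_mapGL_stdLattice_eq_of_isSelfDualLattice_of_ramified` + the two-sided Cartan decomposition of ANY isometric involution ★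
  `exists_frame_mapGL_stdLattice` (the pattern of ★ `exists_frame_three_of_isSelfDualLattice_of_neg`);
* §1 `neighborSet_finite_of_isRamifiedQuadraticDatum` — the LOCAL FINITENESS letter `hloc`: every star is finite (a vertex of the `U(3)` tree is of type `0` or `2`, ★
  `type_eq_zero_or_two_of_isVertexLattice_three`; both stars have `|𝓀_w| + 1` points, ★ `ncard_neighborSet_of_isSelfDualLattice_wild` ∕ ★ `ncard_neighborSet_of_isVertexLattice_two_of_isRamifiedQuadraticDatum`);
* §2 **`coe_unitaryLevel_gqs_subset_mul_of_adj_of_dist_of_ramificationIdx_ne_one`** — (U7) `U_y ⊆ U_x · U_z` along a geodesic, at every ramified place (★ `…_of_involution` with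
  its three tree-side letters discharged: ★ `isTree_latticeGraph_three_of_ramified`, §1 frames, ★ `htr₂_of_isRamifiedQuadraticDatum`);
* §3 **`char_eq_fixedVertexSum_sub_fixedEdgeSum_of_ramificationIdx_ne_one`** — THE HEAD (SS-K) at every ramified place: ★ `char_eq_fixedVertexSum_sub_fixedEdgeSum_of_involution`
  with `hT hloc hfr htr₂` discharged at the datum; every other binder and the conclusion VERBATIM.
HONEST LABEL: count-neutral helper of the WILD chain (row #15's residual `h73w`∕`hX0w` via ★ p855128 §2; the chain's other files per K2E3-p17's map); h413 OPEN; HC_CM is proved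
only modulo the 7 printed citations (2 remaining named inputs hLiu418 = `stmt-HodgeConjecture-24832`, h413 = `stmt-HodgeConjecture-24833`) until rung 0 closes.

## References
* [SchneiderStuhler1997] P. Schneider, U. Stuhler, *Representation theory and sheaves on the Bruhat–Tits building*, Publ. IHÉS 85 (1997): Ch. I §2–§3 (U1)–(U7), Thm. III.4.16.
* [Korman2004] J. Korman, *On the local constancy of characters*, arXiv:math/0409292: §3.6, §9 Claim 39, Thm. 40.
* [BruhatTits1972] F. Bruhat, J. Tits, *Groupes réductifs sur un corps local I*, Publ. Math. IHÉS 41 (1972), (4.4.3), (7.4.18), §10.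
* [Tits1979] J. Tits, *Reductive groups over local fields*, PSPM 33.1 (1979), §2.7 (the ramified quasi-split `²A₂`: a `(q+1, q+1)` tree), §3.3.3.
* [Serre1979] J.-P. Serre, *Local Fields*, GTM 67 (1979), Ch. IV §1–§2 (the different of a ramified quadratic extension).
* [Rogawski1990] J. D. Rogawski, *Automorphic Representations of Unitary Groups in Three Variables* (1990): §12.5 pp. 182–187.
-/

set_option autoImplicit false
-- the mandated namespace has the single-problem summit's repeated segment (`HodgeConjecture.HodgeConjecture`)
set_option linter.dupNamespace false

noncomputable section

open NumberField IsDedekindDomain MeasureTheory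
open scoped Pointwise Valued WithZero
open Literature.NumberTheory.Rogawski1990 Literature.NumberTheory.Rogawski1990.Ch12Sec5
open Literature.NumberTheory.Automorphic Literature.NumberTheory.Automorphic.UnitaryGroup Literature.NumberTheory.Automorphic.UnitaryLatticeTree
open Literature.NumberTheory.Automorphic.HermitianLattice
open Literature.Combinatorics.SimpleGraph Literature.Combinatorics.SimpleGraph.OrientedIncidence
open Literature.NumberTheory.Automorphic.UnitaryThreeFourFrame

namespace Summit.HodgeConjecture.HodgeConjecture.Cruxes.H413.K2E3CharacterEllipticUniformWild

open Summit.HodgeConjecture.HodgeConjecture.Cruxes.H413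
open Summit.HodgeConjecture.HodgeConjecture.Cruxes.H413.F0P3cStCharTSCharacterEllipticUniform
open Summit.HodgeConjecture.HodgeConjecture.Cruxes.H413.F0P3cStCharTSCharacterEllipticUniformRamified
open Summit.HodgeConjecture.HodgeConjecture.Cruxes.H413.F0P3cDyRamWildPlaceDatum
open Summit.HodgeConjecture.HodgeConjecture.Cruxes.H413.F0P3cDyRamWildTransitivity

/-! ## §1 The frames letter `hfr` and the local-finiteness letter `hloc` at a ramified quadratic datum (generic valued field, finite residue field) -/

section Generic

variable {K : Type} [Field K] [Valued K ℤᵐ⁰] [Finite 𝓀[K]] {σ : K →+* K} {ϖ : K} {d t : ℕ}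

/-- **FRAMES OF A SELF-DUAL VERTEX AT A RAMIFIED QUADRATIC DATUM** (wild dyadic included): every self-dual `M` is `κ · L_a` with `κ ∈ K₀` (integral unitary) and `a : ℤ`
— self-dual transitivity at the datum (★ htr₀-WILD `exists_unitary_mapGL_stdLattice_eq_of_isSelfDualLattice_of_ramified`) + the two-sided Cartan decomposition of ANY
isometric involution read on lattices (★ `exists_frame_mapGL_stdLattice`); the datum twin of ★ `exists_frame_three_of_isSelfDualLattice_of_neg` (`|2| = 1`).
[cite: BruhatTits1972, (4.4.3), §10] [cite: Tits1979, §3.3.3] -/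
theorem exists_frame_three_of_isSelfDualLattice_of_isRamifiedQuadraticDatum [ValuativeRel K] [(Valued.v : Valuation K ℤᵐ⁰).Compatible]
    (hD : IsRamifiedQuadraticDatum σ ϖ d t) :
    ∀ M : Submodule 𝒪[K] (Fin 3 → K), IsSelfDualLattice σ ϖ ((StdForm.antidiagonal 3).over K) M →
      ∃ k : unitaryGroupOfForm σ ((StdForm.antidiagonal 3).over K), k ∈ unitaryInt σ ((StdForm.antidiagonal 3).over K) ∧
        ∃ n : ℤ, M = mapGL (k : GL (Fin 3) K) (latt (Matrix.diagonal ![ϖ ^ n, 1, ϖ ^ (-n)])) := by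
  intro M hM
  obtain ⟨hσ, hvσ, hϖ, heven, hd, h1d, h2t⟩ := hD
  obtain ⟨u, hu⟩ := exists_unitary_mapGL_stdLattice_eq_of_isSelfDualLattice_of_ramified hσ hvσ hϖ heven hd h1d h2t M hM
  obtain ⟨κ, hκ, a, ha⟩ := exists_frame_mapGL_stdLattice hσ hvσ hϖ u
  exact ⟨κ, hκ, a, by rw [hu, ha]⟩

/-- **EVERY STAR OF THE `U(3)` TREE IS FINITE AT A RAMIFIED QUADRATIC DATUM**: a vertex is of type `0` or `2` (★ `type_eq_zero_or_two_of_isVertexLattice_three`) and both kinds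
of star have `|𝓀| + 1` points (★ `ncard_neighborSet_of_isSelfDualLattice_wild`, ★ `ncard_neighborSet_of_isVertexLattice_two_of_isRamifiedQuadraticDatum`); the datum twin of the
`m = 1` case of ★ `ncard_sphere_of_neg`. [cite: Tits1979, §2.7] [cite: BruhatTits1972, §10] -/
theorem neighborSet_finite_of_isRamifiedQuadraticDatum (hD : IsRamifiedQuadraticDatum σ ϖ d t)
    (x : {M : Submodule 𝒪[K] (Fin 3 → K) // IsVertex σ ϖ ((StdForm.antidiagonal 3).over K) M}) :
    ((latticeGraph σ ϖ ((StdForm.antidiagonal 3).over K)).neighborSet x).Finite := by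
  have hD' := hD
  obtain ⟨hσ, hvσ, hϖ, heven, hd, h1d, h2t⟩ := hD'
  obtain ⟨dx, hdx⟩ := x.2
  rcases type_eq_zero_or_two_of_isVertexLattice_three hvσ hϖ v_det_antidiagonal_three hdx with rfl | rfl
  · exact Set.finite_of_ncard_ne_zero (by rw [ncard_neighborSet_of_isSelfDualLattice_wild hσ hvσ hϖ heven hd h1d h2t x hdx]; exact Nat.succ_ne_zero _)
  · exact Set.finite_of_ncard_ne_zero (by rw [ncard_neighborSet_of_isVertexLattice_two_of_isRamifiedQuadraticDatum σ ϖ d t hD x hdx]; exact Nat.succ_ne_zero _)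

end Generic

/-! ## §2 (U7) `U_y ⊆ U_x · U_z` along a geodesic, at EVERY ramified place (the datum twin of ★ `…_of_neg`) -/

section Datum

variable (L : Type) [Field L] [NumberField L] [IsCMField L] (v : HeightOneSpectrum (𝓞 ↥(maximalRealSubfield L)))
  (w : PlacesOver L v) (hw : IsCMField.complexConj L • w.1 = w.1) {ϖ : w.1.adicCompletion L}
  (eA : Gqs L v ≃ₜ* ↥(unitaryGroupOfForm (galAdicCompletionMap (L := L) (IsCMField.complexConj L) hw) ((StdForm.antidiagonal 3).over (w.1.adicCompletion L))))

variable {L v w hw eA}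
variable {a : Gqs L v →* ((latticeGraph (galAdicCompletionMap (L := L) (IsCMField.complexConj L) hw) ϖ ((StdForm.antidiagonal 3).over (w.1.adicCompletion L))) ≃g (latticeGraph (galAdicCompletionMap (L := L) (IsCMField.complexConj L) hw) ϖ ((StdForm.antidiagonal 3).over (w.1.adicCompletion L))))} (ha : ∀ g, a g = latticeGraphIso (galAdicCompletionMap (L := L) (IsCMField.complexConj L) hw) ϖ ((StdForm.antidiagonal 3).over (w.1.adicCompletion L)) (eA g))
  {e : ℕ} {U : {M : Submodule 𝒪[(w.1.adicCompletion L)] (Fin 3 → (w.1.adicCompletion L)) // IsVertex (galAdicCompletionMap (L := L) (IsCMField.complexConj L) hw) ϖ ((StdForm.antidiagonal 3).over (w.1.adicCompletion L)) M} → Subgroup (Gqs L v)}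
  (hU : ∀ x g, g ∈ U x ↔ mapGL ((eA g : ↥(unitaryGroupOfForm (galAdicCompletionMap (L := L) (IsCMField.complexConj L) hw) ((StdForm.antidiagonal 3).over (w.1.adicCompletion L)))) : GL (Fin 3) (w.1.adicCompletion L)) x.1 = x.1 ∧
    x.1.map ((Matrix.toLin' ((((eA g : ↥(unitaryGroupOfForm (galAdicCompletionMap (L := L) (IsCMField.complexConj L) hw) ((StdForm.antidiagonal 3).over (w.1.adicCompletion L)))) : GL (Fin 3) (w.1.adicCompletion L)) : Matrix (Fin 3) (Fin 3) (w.1.adicCompletion L)) - 1)).restrictScalars 𝒪[(w.1.adicCompletion L)]) ≤ scaleLattice (ϖ ^ (e + 1)) x.1)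


include hU in
/-- **`hU7` AT EVERY RAMIFIED PLACE** (`e(w∣v) ≠ 1`, any uniformiser; wild dyadic included): the three involution-form hypotheses of ★
`coe_unitaryLevel_gqs_subset_mul_of_adj_of_dist_of_involution` discharged at the ramified quadratic datum by ★ `isTree_latticeGraph_three_of_ramified`, §1
`exists_frame_three_of_isSelfDualLattice_of_isRamifiedQuadraticDatum`, ★ `htr₂_of_isRamifiedQuadraticDatum` — the `_of_ramificationIdx_ne_one` twin of ★ `…_of_neg`, conclusion VERBATIM.
[cite: SchneiderStuhler1997, Prop. I.3.1] [cite: Korman2004, §3.6 (U7)] [cite: BruhatTits1972, (7.4.18)] -/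
theorem coe_unitaryLevel_gqs_subset_mul_of_adj_of_dist_of_ramificationIdx_ne_one
    (hew : v.asIdeal.ramificationIdx' w.1.asIdeal ≠ 1) (hϖ : Valued.v ϖ = WithZero.exp (-1 : ℤ))
    {x y z : {M : Submodule 𝒪[(w.1.adicCompletion L)] (Fin 3 → (w.1.adicCompletion L)) // IsVertex (galAdicCompletionMap (L := L) (IsCMField.complexConj L) hw) ϖ ((StdForm.antidiagonal 3).over (w.1.adicCompletion L)) M}} (hxy : (latticeGraph (galAdicCompletionMap (L := L) (IsCMField.complexConj L) hw) ϖ ((StdForm.antidiagonal 3).over (w.1.adicCompletion L))).Adj x y)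
    (hyz : (latticeGraph (galAdicCompletionMap (L := L) (IsCMField.complexConj L) hw) ϖ ((StdForm.antidiagonal 3).over (w.1.adicCompletion L))).dist y z + 1 = (latticeGraph (galAdicCompletionMap (L := L) (IsCMField.complexConj L) hw) ϖ ((StdForm.antidiagonal 3).over (w.1.adicCompletion L))).dist x z) :
    ((U y : Subgroup (Gqs L v)) : Set (Gqs L v)) ⊆ (U x : Set (Gqs L v)) * (U z : Set (Gqs L v)) := by
  haveI : Finite 𝓀[(w.1.adicCompletion L)] := finite_residueField_adicCompletion (K := L) (v := w.1)
  obtain ⟨nd, nt, hD⟩ := exists_isRamifiedQuadraticDatum_of_placesOver L w hw hew ϖ hϖ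
  obtain ⟨hσ, hvσ, -, heven, hd, h1d, h2t⟩ := id hD
  exact coe_unitaryLevel_gqs_subset_mul_of_adj_of_dist_of_involution hU hσ hvσ hϖ (isTree_latticeGraph_three_of_ramified hσ hvσ hϖ heven hd h1d h2t)
    (exists_frame_three_of_isSelfDualLattice_of_isRamifiedQuadraticDatum hD) (htr₂_of_isRamifiedQuadraticDatum hD) hxy hyz

end Datum

/-! ## §3 THE HEAD (SS-K) UNIFORM AT THE DATUM AT EVERY RAMIFIED PLACE -/

section Head

variable (L : Type) [Field L] [NumberField L] [IsCMField L] (v : HeightOneSpectrum (𝓞 ↥(maximalRealSubfield L)))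

set_option maxHeartbeats 1600000 in
/-- **(SS-K) UNIFORM AT EVERY RAMIFIED PLACE** (`e(w∣v) ≠ 1`, ANY uniformiser `ϖ`; wild dyadic included): ★ `char_eq_fixedVertexSum_sub_fixedEdgeSum_of_involution` with its
tree-side hypotheses DISCHARGED at the ramified quadratic datum — the tree by ★ `isTree_latticeGraph_three_of_ramified`, local finiteness by §1
`neighborSet_finite_of_isRamifiedQuadraticDatum`, the frames by §1 `exists_frame_three_of_isSelfDualLattice_of_isRamifiedQuadraticDatum`, type-two transitivity by ★
`htr₂_of_isRamifiedQuadraticDatum`; binders = ★ `…_of_neg`'s with the tame block `(hσ hvσ hϖ hσϖ hres h2 hnorm)` replaced by `(hew) (hϖ)` (`hew : e(w∣v) ≠ 1`; the head keeps its own `he` = the non-zero fixed vector); conclusion VERBATIM = ★ 41g-H: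
`𝔇.char (IrrClass.mk r) γ = Σ_{x ∈ X^γ⁰} tr(γ | π^{U_x}) − Σ_{d ∈ X^γ¹} tr(γ | π^{U_d})`.
[cite: SchneiderStuhler1997, Thm. III.4.16] [cite: Korman2004, Theorem 40] [cite: Rogawski1990, §12.5 pp. 182–187] [cite: Serre1979, Ch. IV §1–§2] -/
theorem char_eq_fixedVertexSum_sub_fixedEdgeSum_of_ramificationIdx_ne_one
    (hns : ∀ w : PlacesOver L v, IsCMField.complexConj L • w.1 = w.1)
    (w : PlacesOver L v) (hw : IsCMField.complexConj L • w.1 = w.1) {ϖ : w.1.adicCompletion L}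
    (hew : v.asIdeal.ramificationIdx' w.1.asIdeal ≠ 1) (hϖ : Valued.v ϖ = WithZero.exp (-1 : ℤ))
    (eA : Gqs L v ≃ₜ* ↥(unitaryGroupOfForm (galAdicCompletionMap (L := L) (IsCMField.complexConj L) hw) ((StdForm.antidiagonal 3).over (w.1.adicCompletion L))))
    [MeasurableSpace (Gqs L v)] [BorelSpace (Gqs L v)]
    [∀ γ : Gqs L v, MeasurableSpace (Gqs L v ⧸ Subgroup.centralizer ({γ} : Set (Gqs L v)))]
    [MeasurableSpace (Gqs L v ⧸ Subgroup.center (Gqs L v))]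
    {H : Type} [Group H] [TopologicalSpace H] [IsTopologicalGroup H] [MeasurableSpace H]
    (νQv : Measure (Gqs L v)) [νQv.IsHaarMeasure]
    (𝔇 : EllipticData (Gqs L v) H) (hμG : 𝔇.μG = νQv)
    (r : SmoothIrrep (Gqs L v))
    (hrep : ∀ φ : Gqs L v → ℂ, IsLocSmooth φ → (IrrClass.mk r).smoothTrace 𝔇.μG φ = ∫ x, φ x * 𝔇.char (IrrClass.mk r) x ∂𝔇.μG)
    {a : Gqs L v →* ((latticeGraph (galAdicCompletionMap (L := L) (IsCMField.complexConj L) hw) ϖ ((StdForm.antidiagonal 3).over (w.1.adicCompletion L))) ≃g (latticeGraph (galAdicCompletionMap (L := L) (IsCMField.complexConj L) hw) ϖ ((StdForm.antidiagonal 3).over (w.1.adicCompletion L))))} (ha : ∀ g, a g = latticeGraphIso (galAdicCompletionMap (L := L) (IsCMField.complexConj L) hw) ϖ ((StdForm.antidiagonal 3).over (w.1.adicCompletion L)) (eA g))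
    (τ : Orientation (latticeGraph (galAdicCompletionMap (L := L) (IsCMField.complexConj L) hw) ϖ ((StdForm.antidiagonal 3).over (w.1.adicCompletion L)))) (hτ : ∀ d, τ.tail d < τ.head d)
    {e : ℕ} {U : {M : Submodule 𝒪[(w.1.adicCompletion L)] (Fin 3 → (w.1.adicCompletion L)) // IsVertex (galAdicCompletionMap (L := L) (IsCMField.complexConj L) hw) ϖ ((StdForm.antidiagonal 3).over (w.1.adicCompletion L)) M} → Subgroup (Gqs L v)}
    (hU : ∀ x g, g ∈ U x ↔ mapGL ((eA g : ↥(unitaryGroupOfForm (galAdicCompletionMap (L := L) (IsCMField.complexConj L) hw) ((StdForm.antidiagonal 3).over (w.1.adicCompletion L)))) : GL (Fin 3) (w.1.adicCompletion L)) x.1 = x.1 ∧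
      x.1.map ((Matrix.toLin' ((((eA g : ↥(unitaryGroupOfForm (galAdicCompletionMap (L := L) (IsCMField.complexConj L) hw) ((StdForm.antidiagonal 3).over (w.1.adicCompletion L)))) : GL (Fin 3) (w.1.adicCompletion L)) : Matrix (Fin 3) (Fin 3) (w.1.adicCompletion L)) - 1)).restrictScalars 𝒪[(w.1.adicCompletion L)]) ≤ scaleLattice (ϖ ^ (e + 1)) x.1)
    (hUo : ∀ x, IsOpen (U x : Set (Gqs L v))) (hUc : ∀ x, IsCompact (U x : Set (Gqs L v)))
    (hEo : ∀ d : (latticeGraph (galAdicCompletionMap (L := L) (IsCMField.complexConj L) hw) ϖ ((StdForm.antidiagonal 3).over (w.1.adicCompletion L))).edgeSet, IsOpen ((U (τ.head d) ⊔ U (τ.tail d) : Subgroup (Gqs L v)) : Set (Gqs L v)))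
    (hEc : ∀ d : (latticeGraph (galAdicCompletionMap (L := L) (IsCMField.complexConj L) hw) ϖ ((StdForm.antidiagonal 3).over (w.1.adicCompletion L))).edgeSet, IsCompact ((U (τ.head d) ⊔ U (τ.tail d) : Subgroup (Gqs L v)) : Set (Gqs L v)))
    (he : ∃ x₀ : {M : Submodule 𝒪[(w.1.adicCompletion L)] (Fin 3 → (w.1.adicCompletion L)) // IsVertex (galAdicCompletionMap (L := L) (IsCMField.complexConj L) hw) ϖ ((StdForm.antidiagonal 3).over (w.1.adicCompletion L)) M}, r.ρ.fixedPoints (U x₀) ≠ ⊥)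
    {γ : Gqs L v} (hne : ∃ o, a γ o = o) (hfin : {x : {M : Submodule 𝒪[(w.1.adicCompletion L)] (Fin 3 → (w.1.adicCompletion L)) // IsVertex (galAdicCompletionMap (L := L) (IsCMField.complexConj L) hw) ϖ ((StdForm.antidiagonal 3).over (w.1.adicCompletion L)) M} | a γ x = x}.Finite) (hfinE : {d : (latticeGraph (galAdicCompletionMap (L := L) (IsCMField.complexConj L) hw) ϖ ((StdForm.antidiagonal 3).over (w.1.adicCompletion L))).edgeSet | (a γ).mapEdgeSet d = d}.Finite)
    (hHC : ∀ᶠ g in nhds γ, 𝔇.char (IrrClass.mk r) g = 𝔇.char (IrrClass.mk r) γ) :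
    𝔇.char (IrrClass.mk r) γ =
      (∑ x ∈ hfin.toFinset, r.ρ.levelTrace (hUo x) (hUc x) γ) - ∑ d ∈ hfinE.toFinset, r.ρ.levelTrace (hEo d) (hEc d) γ := by
  haveI : Finite 𝓀[(w.1.adicCompletion L)] := finite_residueField_adicCompletion (K := L) (v := w.1)
  obtain ⟨nd, nt, hD⟩ := exists_isRamifiedQuadraticDatum_of_placesOver L w hw hew ϖ hϖ
  obtain ⟨hσ, hvσ, -, heven, hd, h1d, h2t⟩ := id hD
  exact char_eq_fixedVertexSum_sub_fixedEdgeSum_of_involution L v hns w hw hσ hvσ hϖ (isTree_latticeGraph_three_of_ramified hσ hvσ hϖ heven hd h1d h2t)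
    (neighborSet_finite_of_isRamifiedQuadraticDatum hD) (exists_frame_three_of_isSelfDualLattice_of_isRamifiedQuadraticDatum hD) (htr₂_of_isRamifiedQuadraticDatum hD)
    eA νQv 𝔇 hμG r hrep ha τ hτ hU hUo hUc hEo hEc he hne hfin hfinE hHC

end Head

end Summit.HodgeConjecture.HodgeConjecture.Cruxes.H413.K2E3CharacterEllipticUniformWild

end
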